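import Summits.BirchSwinnertonDyer.BirchSwinnertonDyer.Theorems.GenusKolyvaginAtTwoTorsionCellD0TripleTwistEight
import Summits.BirchSwinnertonDyer.BirchSwinnertonDyer.Theorems.GenusKolyvaginAtTwoTorsionCellD0TripleTwistOdd
import Summits.BirchSwinnertonDyer.BirchSwinnertonDyer.Theorems.GenusKolyvaginAtTwoTorsionCellD0NegPrimeTwistCount
import Summits.BirchSwinnertonDyer.BirchSwinnertonDyer.Theorems.GenusKolyvaginAtTwoTorsionCellD0BaseGlue
import Summits.BirchSwinnertonDyer.BirchSwinnertonDyer.Theorems.GenusKolyvaginAtTwoTorsionCellD0RootUnitReciprocity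
import HarnessLib

/-!
# D0≤2: assembly — the three Selmer counts from the hypotheses of LINE 49's full base setting

Crux R″ `RankOneTwoTorsionResidualAtTwo` (stmt-27478), LINE 49 «full_vertex», stub D0≤2
`FullTorsionGenusSelmerLawUpToTwoAtTwo` (`#Q₀ ≤ 2`). This file discharges the bookkeeping hypotheses of the explicit
counts (`…D0NegPrimeTwistCount`, `…D0PairTwistCount`, `…D0TripleTwistBound`, `…D0TripleTwistEight`) from hypotheses in
the SHAPE of LINE 49's `FullBaseSetting` / `IsFullAdmissible` (stated here unfolded, in Literature vocabulary — the line's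
own `def`s live in the Cruxes workfile and are not importable): a globally minimal base `E₀` with two independent rational
`2`-torsion points, rank `0`, `Ш(E₀)[2] = 0`; `p₀ ≡ 7 (mod 8)` with `AllPrimesSplitInSqrt (2N₀) (−p₀)`; full-admissible
primes `q` (`(q, 2N₀) = 1`, `q` inert in `ℚ(√Δ(V))` for every `2`-isogenous `V`) with `AllPrimesSplitInSqrt (2N₀) (q₁q₂)`.
The support set is `S = primes(2N₀)`; the root differences are `S`-units by minimality (`…D0BaseGlue`).

* **`natCard_selmerGroup_negPrime_twist_eq_eight_of_base`** — `#Sel⁽²⁾(E₀^{(−p₀)}/ℚ) = 8` (`Q₀ = ∅`).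
* **`natCard_selmerGroup_pair_twists_of_base`** — for `Q₀ = {q₁, q₂}`: `#Sel⁽²⁾(E₀^{(q₁q₂)}/ℚ) = 4`,
  `#Sel⁽²⁾(E₀^{(−p₀q₁q₂)}/ℚ) ∈ {4, 8}`, and `= 8` if `(q₁q₂/p₀) = 1`.

What is NOT here: `#Sel⁽²⁾(E₀^{(−p₀q₁q₂)}) = 8` when `(q₁q₂/p₀) = −1` (the `2`-parity case), the torsion counts of the models
`C₀, C₁` (`natCard_torsionBy_two_smul_quadraticTwist`, `…D0BaseGlue`), and the transport to models `T • E₀^{(d)}`.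
Everything is proved; no LINE 49 statement is restated; BSD is not advanced by this file alone.

## References

* [SilvermanAEC2009] J. H. Silverman, *The Arithmetic of Elliptic Curves*, 2nd ed., GTM 106, Prop. X.1.4, X.4.9.
* [ShuZhai2021] J. Shu, S. Zhai, *Generalized Birch lemma and the 2-part of the BSD conjecture for certain elliptic
  curves*, arXiv:2102.11808, Def. 1.1, Thm. 1.2.
-/

noncomputable section

open scoped Classical

namespace Summit.BirchSwinnertonDyer.BirchSwinnertonDyer.Theorems.GenusKolyvaginAtTwo.TorsionCellD0

open WeierstrassCurve WeierstrassCurve.Affine WeierstrassCurve.Affine.Point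
open Literature.NumberTheory.GaloisRepresentations Literature.NumberTheory.EllipticCurves Field
open Literature.NumberTheory.EllipticCurves.TwoDescentLocal
open Literature.NumberTheory.EllipticCurves.KramerTwoDescent
open Literature.NumberTheory.QuadraticFields.Quadratic
open IsDedekindDomain NumberField Rat.HeightOneSpectrum

variable (E₀ : WeierstrassCurve ℚ) [E₀.IsElliptic] [E₀.IsGloballyMinimal]

/-! ## The support set `S = primes(2N₀)` -/

section Support

/-- `S = primes(2N₀)` consists of primes. [folklore] -/
private theorem primes_of_mem_primeFactors {n : ℕ} : ∀ q ∈ n.primeFactors, q.Prime :=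
  fun _ hq => Nat.prime_of_mem_primeFactors hq

/-- `2 ∈ primes(2N₀)` (`N₀ ≠ 0`). [folklore] -/
private theorem two_mem_primeFactors {N : ℕ} (hN : N ≠ 0) : 2 ∈ (2 * N).primeFactors :=
  Nat.mem_primeFactors.mpr ⟨Nat.prime_two, dvd_mul_right 2 N, mul_ne_zero two_ne_zero hN⟩

/-- A prime outside `primes(2N₀)` is odd and prime to `N₀`. [folklore] -/
private theorem ne_two_and_not_dvd_of_not_mem {N : ℕ} (hN : N ≠ 0) {ℓ : ℕ} (hℓ : ℓ.Prime) (hℓS : ℓ ∉ (2 * N).primeFactors) :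
    ℓ ≠ 2 ∧ ¬ ℓ ∣ N := by
  have hnd : ¬ ℓ ∣ 2 * N := fun hd => hℓS (Nat.mem_primeFactors.mpr ⟨hℓ, hd, mul_ne_zero two_ne_zero hN⟩)
  exact ⟨fun h2 => hnd (h2 ▸ dvd_mul_right 2 N), fun hd => hnd (Dvd.dvd.mul_left hd 2)⟩

/-- **The root differences of a globally minimal full-torsion base are units off `primes(2N₀)`.**
[cite: SilvermanAEC2009, VIII.8, Prop. X.1.4] -/
theorem padicValRat_sub_roots_eq_zero_of_not_mem_primeFactors {e₁ e₂ e₃ : ℚ} (h : E₀.toAffine.SplitTwoTorsion e₁ e₂ e₃)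
    (hN : E₀.conductorNorm ℤ ≠ 0) (ℓ : ℕ) (hℓ : ℓ.Prime) (hℓS : ℓ ∉ (2 * E₀.conductorNorm ℤ).primeFactors) :
    haveI : Fact ℓ.Prime := ⟨hℓ⟩
    padicValRat ℓ (e₁ - e₂) = 0 ∧ padicValRat ℓ (e₁ - e₃) = 0 ∧ padicValRat ℓ (e₂ - e₃) = 0 := by
  haveI : Fact ℓ.Prime := ⟨hℓ⟩
  obtain ⟨hℓ2, hℓN⟩ := ne_two_and_not_dvd_of_not_mem hN hℓ hℓS
  exact padicValRat_sub_roots_eq_zero_of_not_dvd_conductorNorm E₀ h hℓ2 hℓN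

/-- `−p` is square-free and not a square. [folklore] -/
private theorem squarefree_and_not_isSquare_neg_prime {p : ℕ} (hp : p.Prime) :
    Squarefree (-(p : ℤ)) ∧ ¬ IsSquare (-(p : ℤ)) := by
  refine ⟨Int.squarefree_natAbs.mp (by rw [Int.natAbs_neg, Int.natAbs_natCast]; exact hp.prime.squarefree), ?_⟩
  rintro ⟨r, hr⟩
  have : (0 : ℤ) < p := by exact_mod_cast hp.pos
  nlinarith [mul_self_nonneg r]

/-- `q₁q₂` (distinct primes) is square-free and not a square. [folklore] -/
private theorem squarefree_and_not_isSquare_mul_primes {q₁ q₂ : ℕ} (hq₁ : q₁.Prime) (hq₂ : q₂.Prime) (hne : q₁ ≠ q₂) :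
    Squarefree ((q₁ : ℤ) * q₂) ∧ ¬ IsSquare ((q₁ : ℤ) * q₂) := by
  have hsf : Squarefree ((q₁ : ℤ) * q₂) := by
    have : Squarefree (q₁ * q₂) :=
      (Nat.squarefree_mul ((Nat.coprime_primes hq₁ hq₂).mpr hne)).mpr ⟨hq₁.prime.squarefree, hq₂.prime.squarefree⟩
    exact_mod_cast Int.squarefree_natCast.mpr this
  refine ⟨hsf, ?_⟩
  rintro ⟨r, hr⟩
  have hu : IsUnit r := hsf r ⟨1, by rw [mul_one]; exact hr⟩
  rcases Int.isUnit_iff.mp hu with h1 | h1 <;>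
  · rw [h1] at hr; norm_num at hr
    have := hq₁.two_le; have := hq₂.two_le
    have : (4 : ℤ) ≤ (q₁ : ℤ) * q₂ := by nlinarith
    omega

/-- **`AllPrimesSplitInSqrt (2N₀) (−p₀)` in symbols**: `p₀ ∉ primes(2N₀)` and `(−p₀/ℓ) = 1` for every odd `ℓ ∈ primes(2N₀)`.
[cite: ShuZhai2021, Thm. 1.2] -/
theorem negPrime_symbols_of_allPrimesSplitInSqrt {N p : ℕ} (hp : p.Prime) (hp2 : p ≠ 2)
    (h : ShuZhai2021.AllPrimesSplitInSqrt (2 * N) (-(p : ℤ))) :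
    p ∉ (2 * N).primeFactors ∧
      ∀ ℓ ∈ (2 * N).primeFactors, (hℓ : ℓ.Prime) → ℓ ≠ 2 → haveI : Fact ℓ.Prime := ⟨hℓ⟩; legendreSym ℓ (-(p : ℤ)) = 1 := by
  obtain ⟨hsf, hnsq⟩ := squarefree_and_not_isSquare_neg_prime hp
  refine ⟨fun hpS => ?_, fun ℓ hℓS hℓ hℓ2 => ?_⟩
  · haveI : Fact p.Prime := ⟨hp⟩
    have := (not_dvd_and_legendreSym_eq_one_of_allPrimesSplitInSqrt h hnsq hsf hp2 (Nat.dvd_of_mem_primeFactors hpS)).1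
    exact this ⟨-1, by ring⟩
  · haveI : Fact ℓ.Prime := ⟨hℓ⟩
    exact (not_dvd_and_legendreSym_eq_one_of_allPrimesSplitInSqrt h hnsq hsf hℓ2 (Nat.dvd_of_mem_primeFactors hℓS)).2

/-- **`AllPrimesSplitInSqrt (2N₀) (q₁q₂)` in symbols**: `q₁q₂ ≡ 1 (mod 8)` and `(q₁q₂/ℓ) = 1` for odd `ℓ ∈ primes(2N₀)`.
[cite: ShuZhai2021, Thm. 1.2] -/
theorem pair_symbols_of_allPrimesSplitInSqrt {N q₁ q₂ : ℕ} (hq₁ : q₁.Prime) (hq₂ : q₂.Prime) (hne : q₁ ≠ q₂)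
    (h : ShuZhai2021.AllPrimesSplitInSqrt (2 * N) ((q₁ : ℤ) * q₂)) :
    ((q₁ : ℤ) * q₂) % 8 = 1 ∧
      ∀ ℓ ∈ (2 * N).primeFactors, (hℓ : ℓ.Prime) → ℓ ≠ 2 → haveI : Fact ℓ.Prime := ⟨hℓ⟩; legendreSym ℓ ((q₁ : ℤ) * q₂) = 1 := by
  obtain ⟨hsf, hnsq⟩ := squarefree_and_not_isSquare_mul_primes hq₁ hq₂ hne
  refine ⟨emod_eight_eq_one_of_allPrimesSplitInSqrt h hnsq hsf (dvd_mul_right 2 N), fun ℓ hℓS hℓ hℓ2 => ?_⟩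
  haveI : Fact ℓ.Prime := ⟨hℓ⟩
  exact (not_dvd_and_legendreSym_eq_one_of_allPrimesSplitInSqrt h hnsq hsf hℓ2 (Nat.dvd_of_mem_primeFactors hℓS)).2

end Support

/-! ## `Q₀ = ∅`: `#Sel⁽²⁾(E₀^{(−p₀)}) = 8` -/

section Empty

/-- **`#Sel⁽²⁾(E₀^{(−p₀)}/ℚ) = 8` from the full base setting** (`Q₀ = ∅`): a globally minimal `E₀` with two independent
rational `2`-torsion points, rank `0`, `Ш(E₀)[2] = 0`, a prime `p₀ ≡ 7 (mod 8)` with every `ℓ ∣ 2N₀` split in `ℚ(√−p₀)`.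
[cite: SilvermanAEC2009, Prop. X.1.4, Prop. X.4.9] [cite: ShuZhai2021, Thm. 1.2] -/
theorem natCard_selmerGroup_negPrime_twist_eq_eight_of_base [inst : DecidableEq ℚ] (hN : E₀.conductorNorm ℤ ≠ 0)
    {P Q : E₀.toAffine.Point}
    (hPQ : P ≠ Q) (hP0 : P ≠ 0) (hQ0 : Q ≠ 0) (hP2 : (2 : ℕ) • P = 0) (hQ2 : (2 : ℕ) • Q = 0)
    (hrank : E₀.mordellWeilRank = 0) (hsha : ∀ x ∈ E₀.sha, (2 : ℕ) • x = 0 → x = 0)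
    {p₀ : ℕ} [hp : Fact p₀.Prime] (hp8 : p₀ % 8 = 7)
    (hsplitp : ShuZhai2021.AllPrimesSplitInSqrt (2 * E₀.conductorNorm ℤ) (-(p₀ : ℤ)))
    [(E₀.quadraticTwist (-(p₀ : ℚ))).IsElliptic] :
    Nat.card (selmerGroup (E₀.quadraticTwist (-(p₀ : ℚ))) 2) = 8 := by
  have e : inst = fun a b => Classical.propDecidable (a = b) := Subsingleton.elim _ _
  subst e
  obtain ⟨a, b, c, habc⟩ := exists_splitTwoTorsion_of_two_torsion_points E₀ hPQ hP0 hQ0 hP2 hQ2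
  obtain ⟨e₁, e₂, e₃, h12, h23, h⟩ := exists_splitTwoTorsion_lt habc
  have hp2 : p₀ ≠ 2 := by rintro rfl; norm_num at hp8
  obtain ⟨hpS, hsplit⟩ := negPrime_symbols_of_allPrimesSplitInSqrt hp.out hp2 hsplitp
  exact natCard_selmerGroup_twist_negPrime_eq_eight E₀ _ h primes_of_mem_primeFactors (two_mem_primeFactors hN) h12
    (h12.trans h23) (padicValRat_sub_roots_eq_zero_of_not_mem_primeFactors E₀ h hN)
    (fun ℓ hℓ hℓS => (ne_two_and_not_dvd_of_not_mem hN hℓ hℓS).2) hrank hsha hpS hp8 hsplit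

end Empty

/-! ## `Q₀ = {q₁, q₂}`: `#Sel⁽²⁾(E₀^{(q₁q₂)}) = 4`, `#Sel⁽²⁾(E₀^{(−p₀q₁q₂)}) ∈ {4, 8}`, `= 8` if `(q₁q₂/p₀) = 1` -/

section Pair

/-- **The `#Q₀ = 2` counts from the full base setting.** `E₀` globally minimal with two independent rational
`2`-torsion points, rank `0`, `Ш(E₀)[2] = 0`; `p₀ ≡ 7 (mod 8)` with every `ℓ ∣ 2N₀` split in `ℚ(√−p₀)`; two distinct
full-admissible primes `q₁, q₂ ≠ p₀` (`(qᵢ, 2N₀) = 1`, `qᵢ` inert in `ℚ(√Δ(V))` for every `2`-isogenous `V`) with every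
`ℓ ∣ 2N₀` split in `ℚ(√q₁q₂)`. Then `#Sel⁽²⁾(E₀^{(q₁q₂)}/ℚ) = 4`, `#Sel⁽²⁾(E₀^{(−p₀q₁q₂)}/ℚ) ∈ {4, 8}`, and `= 8` if
`(q₁q₂/p₀) = 1`. [cite: SilvermanAEC2009, Prop. X.1.4, Prop. X.4.9] [cite: ShuZhai2021, Def. 1.1, Thm. 1.2] -/
theorem natCard_selmerGroup_pair_twists_of_base [inst : DecidableEq ℚ] (hN : E₀.conductorNorm ℤ ≠ 0)
    {P Q : E₀.toAffine.Point} (hPQ : P ≠ Q) (hP0 : P ≠ 0) (hQ0 : Q ≠ 0) (hP2 : (2 : ℕ) • P = 0) (hQ2 : (2 : ℕ) • Q = 0)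
    (hrank : E₀.mordellWeilRank = 0) (hsha : ∀ x ∈ E₀.sha, (2 : ℕ) • x = 0 → x = 0)
    {p₀ : ℕ} [hp : Fact p₀.Prime] (hp8 : p₀ % 8 = 7)
    (hsplitp : ShuZhai2021.AllPrimesSplitInSqrt (2 * E₀.conductorNorm ℤ) (-(p₀ : ℤ)))
    {q₁ q₂ : ℕ} [hq₁ : Fact q₁.Prime] [hq₂ : Fact q₂.Prime] (hne : q₁ ≠ q₂) (hq₁p : q₁ ≠ p₀) (hq₂p : q₂ ≠ p₀)
    (hcop₁ : Nat.Coprime q₁ (2 * E₀.conductorNorm ℤ)) (hcop₂ : Nat.Coprime q₂ (2 * E₀.conductorNorm ℤ))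
    (hadm₁ : ∀ (V : WeierstrassCurve ℚ) [V.IsElliptic], (∃ φ : Isogeny E₀ V, φ.degree = 2) → ShuZhai2021.IsInertInSqrt q₁ V.Δ)
    (hadm₂ : ∀ (V : WeierstrassCurve ℚ) [V.IsElliptic], (∃ φ : Isogeny E₀ V, φ.degree = 2) → ShuZhai2021.IsInertInSqrt q₂ V.Δ)
    (hsplitM : ShuZhai2021.AllPrimesSplitInSqrt (2 * E₀.conductorNorm ℤ) ((q₁ : ℤ) * q₂))
    [(E₀.quadraticTwist ((q₁ : ℚ) * q₂)).IsElliptic] [(E₀.quadraticTwist (-(p₀ : ℚ) * ((q₁ : ℚ) * q₂))).IsElliptic] :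
    Nat.card (selmerGroup (E₀.quadraticTwist ((q₁ : ℚ) * q₂)) 2) = 4 ∧
      (Nat.card (selmerGroup (E₀.quadraticTwist (-(p₀ : ℚ) * ((q₁ : ℚ) * q₂))) 2) = 4 ∨
        Nat.card (selmerGroup (E₀.quadraticTwist (-(p₀ : ℚ) * ((q₁ : ℚ) * q₂))) 2) = 8) ∧
      (legendreSym p₀ ((q₁ : ℤ) * q₂) = 1 → Nat.card (selmerGroup (E₀.quadraticTwist (-(p₀ : ℚ) * ((q₁ : ℚ) * q₂))) 2) = 8) := by
  have e : inst = fun a b => Classical.propDecidable (a = b) := Subsingleton.elim _ _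
  subst e
  obtain ⟨a, b, c, habc⟩ := exists_splitTwoTorsion_of_two_torsion_points E₀ hPQ hP0 hQ0 hP2 hQ2
  obtain ⟨e₁, e₂, e₃, h12, h23, h⟩ := exists_splitTwoTorsion_lt habc
  have h13 : e₁ < e₃ := h12.trans h23
  have hp2 : p₀ ≠ 2 := by rintro rfl; norm_num at hp8
  -- the support set and its properties
  have hS := @primes_of_mem_primeFactors (2 * E₀.conductorNorm ℤ)
  have h2S := two_mem_primeFactors hN
  have hgood := padicValRat_sub_roots_eq_zero_of_not_mem_primeFactors E₀ h hN
  have hNS : ∀ ℓ : ℕ, ℓ.Prime → ℓ ∉ (2 * E₀.conductorNorm ℤ).primeFactors → ¬ ℓ ∣ E₀.conductorNorm ℤ :=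
    fun ℓ hℓ hℓS => (ne_two_and_not_dvd_of_not_mem hN hℓ hℓS).2
  obtain ⟨hpS, hsplitp'⟩ := negPrime_symbols_of_allPrimesSplitInSqrt hp.out hp2 hsplitp
  obtain ⟨hM8, hsplitM'⟩ := pair_symbols_of_allPrimesSplitInSqrt hq₁.out hq₂.out hne hsplitM
  have hqS : ∀ {q : ℕ}, q.Prime → Nat.Coprime q (2 * E₀.conductorNorm ℤ) → q ∉ (2 * E₀.conductorNorm ℤ).primeFactors := by
    intro q hq hcop hqS
    have hdvd := Nat.dvd_of_mem_primeFactors hqS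
    have := Nat.Coprime.eq_one_of_dvd hcop hdvd
    exact hq.ne_one this
  have hq₁S := hqS hq₁.out hcop₁
  have hq₂S := hqS hq₂.out hcop₂
  have hq₁2 : q₁ ≠ 2 := fun h2 => hq₁S (h2 ▸ h2S)
  have hq₂2 : q₂ ≠ 2 := fun h2 => hq₂S (h2 ▸ h2S)
  -- integrality of `4eᵢ` and the unit root differences at `q₁, q₂, p₀`
  obtain ⟨n₁, hn₁⟩ := exists_intCast_eq_four_mul_root E₀ h
  obtain ⟨n₂, hn₂⟩ := exists_intCast_eq_four_mul_root E₀ h.swap₁₂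
  obtain ⟨n₃, hn₃⟩ := exists_intCast_eq_four_mul_root E₀ h.swap₂₃.swap₁₂
  obtain ⟨g12₁, g13₁, g23₁⟩ := hgood q₁ hq₁.out hq₁S
  obtain ⟨g12₂, g13₂, g23₂⟩ := hgood q₂ hq₂.out hq₂S
  -- full admissibility in residue bits, and `qᵢ ≡ 3 (mod 4)`
  obtain ⟨hδ₁₁, hδ₂₁, hδ₃₁⟩ := qrBit_delta_eq_one_of_forall_isogeny E₀ h hq₁2 hn₁ hn₂ hn₃ g12₁ g13₁ g23₁ hadm₁
  obtain ⟨hδ₁₂, hδ₂₂, hδ₃₂⟩ := qrBit_delta_eq_one_of_forall_isogeny E₀ h hq₂2 hn₁ hn₂ hn₃ g12₂ g13₂ g23₂ hadm₂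
  have hq₁4 := emod_four_eq_three_of_qrBit_delta E₀ h hq₁2 hδ₁₁ hδ₂₁ hδ₃₁
  have hq₂4 := emod_four_eq_three_of_qrBit_delta E₀ h hq₂2 hδ₁₂ hδ₂₂ hδ₃₂
  -- (R1) termwise and the transport `qr_{q₂}(e₂ − e₁) = qr_{q₁}(e₂ − e₁)`
  have hR1 : ∀ ℓ ∈ (2 * E₀.conductorNorm ℤ).primeFactors, qrBit q₂ (ℓ : ℚ) = qrBit q₁ (ℓ : ℚ) := by
    intro ℓ hℓ
    by_cases hℓ2 : ℓ = 2
    · subst hℓ2; exact_mod_cast (qrBit_two_eq_qrBit_two_of_mul_emod_eight hq₁4 hq₂4 hM8).symm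
    · exact (qrBit_eq_qrBit_of_legendreSym_mul_eq_one hq₁4 hq₂4 (hS ℓ hℓ) hℓ2 (fun h => hq₁S (h ▸ hℓ))
        (fun h => hq₂S (h ▸ hℓ)) (hsplitM' ℓ hℓ (hS ℓ hℓ) hℓ2)).symm
  have ht : qrBit q₂ (e₂ - e₁) = qrBit q₁ (e₂ - e₁) :=
    qrBit_sub_roots_eq_of_intCast hn₁ hn₂ h.ne₁₂ _ h2S (fun ℓ hℓ hℓS => (hgood ℓ hℓ hℓS).1)
      (by rw [qrBit_neg_one_eq_one_of_emod_four hq₁4, qrBit_neg_one_eq_one_of_emod_four hq₂4]) hR1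
  refine ⟨?_, ?_, fun hleg => ?_⟩
  · exact natCard_selmerGroup_twist_pair_eq_four E₀ _ h hS h2S hgood hNS hrank hsha hq₁S hq₂S hne hq₁4 hq₂4 hM8 hsplitM'
      hδ₁₁ hδ₂₁ hδ₁₂ hδ₂₂
  · exact natCard_selmerGroup_twist_triple_eq_four_or_eight E₀ _ h hS h2S h12 h23 hgood hNS hrank hsha hpS hq₁S hq₂S
      (Ne.symm hq₁p) (Ne.symm hq₂p) hne hp8 hq₁4 hq₂4 hM8 hsplitp' hsplitM' hδ₁₁ hδ₂₁ hδ₁₂ hδ₂₂ ht rfl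
  · -- (R2) termwise: `qr_{p₀}` kills the primes of `S`; so `e₃ − e₁`, `e₃ − e₂ > 0` are residues at `p₀`
    have hR2 : ∀ ℓ ∈ (2 * E₀.conductorNorm ℤ).primeFactors, qrBit p₀ (ℓ : ℚ) = 0 := by
      intro ℓ hℓ
      by_cases hℓ2 : ℓ = 2
      · rw [hℓ2]; exact_mod_cast qrBit_two_eq_zero hp8
      · exact qrBit_prime_eq_zero_of_legendreSym hp8 (hS ℓ hℓ) hℓ2 (fun h => hpS (h ▸ hℓ)) (hsplitp' ℓ hℓ (hS ℓ hℓ) hℓ2)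
    have hr₁ : qrBit p₀ (e₃ - e₁) = 0 :=
      qrBit_sub_roots_eq_zero_of_intCast hn₁ hn₃ h13 _ h2S (fun ℓ hℓ hℓS => (hgood ℓ hℓ hℓS).2.1) hR2
    have hr₂ : qrBit p₀ (e₃ - e₂) = 0 :=
      qrBit_sub_roots_eq_zero_of_intCast hn₂ hn₃ h23 _ h2S (fun ℓ hℓ hℓS => (hgood ℓ hℓ hℓS).2.2) hR2
    -- `(q₁q₂/p₀) = 1`: `qr_{p₀}(q₁) = qr_{p₀}(q₂)`
    have hw : qrBit p₀ (q₁ : ℚ) = qrBit p₀ (q₂ : ℚ) := by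
      have hj : jacobiSym ((q₁ : ℤ) * q₂) p₀ = 1 := by rw [← jacobiSym.legendreSym.to_jacobiSym]; exact hleg
      have h0 := qrBit_intCast_of_jacobiSym_eq_one (p := p₀) hj
      push_cast at h0
      rw [qrBit_mul p₀ (by exact_mod_cast hq₁.out.ne_zero) (by exact_mod_cast hq₂.out.ne_zero)] at h0
      revert h0; generalize qrBit p₀ (q₁ : ℚ) = x; generalize qrBit p₀ (q₂ : ℚ) = y; revert x y; decide
    exact natCard_selmerGroup_twist_triple_eq_eight_of_qrBit_eq E₀ _ h hS h2S h12 h23 hgood hNS hrank hsha hpS hq₁S hq₂S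
      (Ne.symm hq₁p) (Ne.symm hq₂p) hne hp8 hq₁4 hq₂4 hM8 hsplitp' hsplitM' hδ₁₁ hδ₂₁ hδ₁₂ hδ₂₂ ht hr₁ hr₂ hw rfl

end Pair

/-! ## `#Q₀ = 2`, both signs: `#Sel⁽²⁾(E₀^{(−p₀q₁q₂)}) = 8` unconditionally (appended 2026-08-31) -/

section PairEight

/-- **The `#Q₀ = 2` counts, complete**: in the setting of `natCard_selmerGroup_pair_twists_of_base` (globally minimal
full-torsion base of rank `0` with `Ш[2] = 0`, `p₀ ≡ 7 (mod 8)` split at `2N₀`, two full-admissible primes `q₁ ≠ q₂` with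
`AllPrimesSplitInSqrt (2N₀) (q₁q₂)`), `#Sel⁽²⁾(E₀^{(q₁q₂)}/ℚ) = 4` AND `#Sel⁽²⁾(E₀^{(−p₀q₁q₂)}/ℚ) = 8` for EITHER value of
`(q₁q₂/p₀)` — the `2`-parity half (`(q₁q₂/p₀) = −1`) is `…D0TripleTwistOdd.natCard_selmerGroup_twist_triple_eq_eight`
(explicit Klagsbrun–Mazur–Rubin parity; no Cassels–Tate or parity-conjecture input).
[cite: SilvermanAEC2009, Prop. X.4.9] [cite: KlagsbrunMazurRubin2013, Thm. 3.9] -/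
theorem natCard_selmerGroup_pair_twists_eq_of_base [inst : DecidableEq ℚ] (hN : E₀.conductorNorm ℤ ≠ 0)
    {P Q : E₀.toAffine.Point} (hPQ : P ≠ Q) (hP0 : P ≠ 0) (hQ0 : Q ≠ 0) (hP2 : (2 : ℕ) • P = 0) (hQ2 : (2 : ℕ) • Q = 0)
    (hrank : E₀.mordellWeilRank = 0) (hsha : ∀ x ∈ E₀.sha, (2 : ℕ) • x = 0 → x = 0)
    {p₀ : ℕ} [hp : Fact p₀.Prime] (hp8 : p₀ % 8 = 7)
    (hsplitp : ShuZhai2021.AllPrimesSplitInSqrt (2 * E₀.conductorNorm ℤ) (-(p₀ : ℤ)))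
    {q₁ q₂ : ℕ} [hq₁ : Fact q₁.Prime] [hq₂ : Fact q₂.Prime] (hne : q₁ ≠ q₂) (hq₁p : q₁ ≠ p₀) (hq₂p : q₂ ≠ p₀)
    (hcop₁ : Nat.Coprime q₁ (2 * E₀.conductorNorm ℤ)) (hcop₂ : Nat.Coprime q₂ (2 * E₀.conductorNorm ℤ))
    (hadm₁ : ∀ (V : WeierstrassCurve ℚ) [V.IsElliptic], (∃ φ : Isogeny E₀ V, φ.degree = 2) → ShuZhai2021.IsInertInSqrt q₁ V.Δ)
    (hadm₂ : ∀ (V : WeierstrassCurve ℚ) [V.IsElliptic], (∃ φ : Isogeny E₀ V, φ.degree = 2) → ShuZhai2021.IsInertInSqrt q₂ V.Δ)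
    (hsplitM : ShuZhai2021.AllPrimesSplitInSqrt (2 * E₀.conductorNorm ℤ) ((q₁ : ℤ) * q₂))
    [(E₀.quadraticTwist ((q₁ : ℚ) * q₂)).IsElliptic] [(E₀.quadraticTwist (-(p₀ : ℚ) * ((q₁ : ℚ) * q₂))).IsElliptic] :
    Nat.card (selmerGroup (E₀.quadraticTwist ((q₁ : ℚ) * q₂)) 2) = 4 ∧
      Nat.card (selmerGroup (E₀.quadraticTwist (-(p₀ : ℚ) * ((q₁ : ℚ) * q₂))) 2) = 8 := by
  have e : inst = fun a b => Classical.propDecidable (a = b) := Subsingleton.elim _ _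
  subst e
  obtain ⟨a, b, c, habc⟩ := exists_splitTwoTorsion_of_two_torsion_points E₀ hPQ hP0 hQ0 hP2 hQ2
  obtain ⟨e₁, e₂, e₃, h12, h23, h⟩ := exists_splitTwoTorsion_lt habc
  have hp2 : p₀ ≠ 2 := by rintro rfl; norm_num at hp8
  have hS := @primes_of_mem_primeFactors (2 * E₀.conductorNorm ℤ)
  have h2S := two_mem_primeFactors hN
  have hgood := padicValRat_sub_roots_eq_zero_of_not_mem_primeFactors E₀ h hN
  have hNS : ∀ ℓ : ℕ, ℓ.Prime → ℓ ∉ (2 * E₀.conductorNorm ℤ).primeFactors → ¬ ℓ ∣ E₀.conductorNorm ℤ :=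
    fun ℓ hℓ hℓS => (ne_two_and_not_dvd_of_not_mem hN hℓ hℓS).2
  obtain ⟨hpS, hsplitp'⟩ := negPrime_symbols_of_allPrimesSplitInSqrt hp.out hp2 hsplitp
  obtain ⟨hM8, hsplitM'⟩ := pair_symbols_of_allPrimesSplitInSqrt hq₁.out hq₂.out hne hsplitM
  have hqS : ∀ {q : ℕ}, q.Prime → Nat.Coprime q (2 * E₀.conductorNorm ℤ) → q ∉ (2 * E₀.conductorNorm ℤ).primeFactors := by
    intro q hq hcop hqS
    exact hq.ne_one (Nat.Coprime.eq_one_of_dvd hcop (Nat.dvd_of_mem_primeFactors hqS))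
  have hq₁S := hqS hq₁.out hcop₁
  have hq₂S := hqS hq₂.out hcop₂
  have hq₁2 : q₁ ≠ 2 := fun h2 => hq₁S (h2 ▸ h2S)
  have hq₂2 : q₂ ≠ 2 := fun h2 => hq₂S (h2 ▸ h2S)
  obtain ⟨n₁, hn₁⟩ := exists_intCast_eq_four_mul_root E₀ h
  obtain ⟨n₂, hn₂⟩ := exists_intCast_eq_four_mul_root E₀ h.swap₁₂
  obtain ⟨n₃, hn₃⟩ := exists_intCast_eq_four_mul_root E₀ h.swap₂₃.swap₁₂
  obtain ⟨g12₁, g13₁, g23₁⟩ := hgood q₁ hq₁.out hq₁S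
  obtain ⟨g12₂, g13₂, g23₂⟩ := hgood q₂ hq₂.out hq₂S
  obtain ⟨hδ₁₁, hδ₂₁, hδ₃₁⟩ := qrBit_delta_eq_one_of_forall_isogeny E₀ h hq₁2 hn₁ hn₂ hn₃ g12₁ g13₁ g23₁ hadm₁
  obtain ⟨hδ₁₂, hδ₂₂, hδ₃₂⟩ := qrBit_delta_eq_one_of_forall_isogeny E₀ h hq₂2 hn₁ hn₂ hn₃ g12₂ g13₂ g23₂ hadm₂
  have hq₁4 := emod_four_eq_three_of_qrBit_delta E₀ h hq₁2 hδ₁₁ hδ₂₁ hδ₃₁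
  have hq₂4 := emod_four_eq_three_of_qrBit_delta E₀ h hq₂2 hδ₁₂ hδ₂₂ hδ₃₂
  have hR1 : ∀ ℓ ∈ (2 * E₀.conductorNorm ℤ).primeFactors, qrBit q₂ (ℓ : ℚ) = qrBit q₁ (ℓ : ℚ) := by
    intro ℓ hℓ
    by_cases hℓ2 : ℓ = 2
    · subst hℓ2; exact_mod_cast (qrBit_two_eq_qrBit_two_of_mul_emod_eight hq₁4 hq₂4 hM8).symm
    · exact (qrBit_eq_qrBit_of_legendreSym_mul_eq_one hq₁4 hq₂4 (hS ℓ hℓ) hℓ2 (fun h => hq₁S (h ▸ hℓ))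
        (fun h => hq₂S (h ▸ hℓ)) (hsplitM' ℓ hℓ (hS ℓ hℓ) hℓ2)).symm
  have ht : qrBit q₂ (e₂ - e₁) = qrBit q₁ (e₂ - e₁) :=
    qrBit_sub_roots_eq_of_intCast hn₁ hn₂ h.ne₁₂ _ h2S (fun ℓ hℓ hℓS => (hgood ℓ hℓ hℓS).1)
      (by rw [qrBit_neg_one_eq_one_of_emod_four hq₁4, qrBit_neg_one_eq_one_of_emod_four hq₂4]) hR1
  exact ⟨natCard_selmerGroup_twist_pair_eq_four E₀ _ h hS h2S hgood hNS hrank hsha hq₁S hq₂S hne hq₁4 hq₂4 hM8 hsplitM'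
      hδ₁₁ hδ₂₁ hδ₁₂ hδ₂₂,
    natCard_selmerGroup_twist_triple_eq_eight E₀ _ h hS h2S h12 h23 hgood hNS hrank hsha hpS hq₁S hq₂S
      (Ne.symm hq₁p) (Ne.symm hq₂p) hne hp8 hq₁4 hq₂4 hM8 hsplitp' hsplitM' hδ₁₁ hδ₂₁ hδ₁₂ hδ₂₂ ht rfl⟩

end PairEight

end Summit.BirchSwinnertonDyer.BirchSwinnertonDyer.Theorems.GenusKolyvaginAtTwo.TorsionCellD0

end
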